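import Summits.BirchSwinnertonDyer.BirchSwinnertonDyer.Theorems.Rank1ResidualJetSignedDualityRelaxed
import HarnessLib

/-!
# T1 JET (cell `bsd-jet`), road K, stub S1 → row form: the signed counting for two structures that
# differ at a SWAPPED PAIR of places `{v₀, σ v₀}` (Jetchev 2008, Thm. 5.1 at the split carrier `q`)

HONEST FRAMING (programme file `BSD-LIT2PART-PROGRAMME-v1.md` §HONESTY, verbatim): «no tranche here
proves BSD; ARM L moves the LITERAL column of an r ≤ 1 census into the kernel-proved-modulo-named-print
column; ARM P changes what «named print» is worth.» THEOREMS ONLY (seat `bsd-jet-pv-1`, session g5;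
`--supports stmt-BirchSwinnertonDyer-14418`, helper): no definition, no named fact, no `sorry`.
Nothing is booked; 0 classes move.

## What

For `σ`-stable Selmer structures `𝓕 ≤ 𝓖` on `E[n]` as in the signed end products which AGREE away
from a swapped pair of finite places `v₀ ≠ σ v₀` of `T` (Jetchev: `𝓕 = 𝓕_⌈q⌉(c) ≤ 𝓖 = 𝓕(c)` at a
carrier `q = v₀ v̄₀` split in `K`), and either sign `s = ±1`:

* `relIndex_mul_relIndex_eq_of_pair` — `[H¹_𝓖 ∩ H^s : H¹_𝓕 ∩ H^s] · [H¹_{𝓕^*} ∩ (H^D)^s :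
  H¹_{𝓖^*} ∩ (H^D)^s] = [𝓖_{v₀} : 𝓕_{v₀}]` (the signed end products + the swapped-pair evaluation
  `relIndex_pi_inf_ker_add_id_eq_of_swap`, with `−τ_X` for `s = 1`);
* `mem_selmerGroup_iff_localization_mem_of_pair` ∕ `mem_dualSelmerGroup_iff_localization_mem_of_pair`
  — on `s`-eigenclasses membership in the smaller (dual: larger) Selmer group is decided AT `v₀` ALONE
  (the condition at `σ v₀` follows by `loc_{σv₀} x = s · σ_*(loc_{v₀} x)`): the kernels of the maps
  `locq`, `locq'` of the hypothesis `hdual_q` of `JET.tamagawaExponent_le_mInfty_of_rowData`;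
* `relIndex_dualLocalCondition_eq` — the local count `[𝓕_{v₀}^⊥ : 𝓖_{v₀}^⊥] = [𝓖_{v₀} : 𝓕_{v₀}]`, and
  `isAddCyclic_dualQuotient_of_isAddCyclic` — `𝓕_{v₀}^⊥/𝓖_{v₀}^⊥ ↪ Hom(𝓖_{v₀}/𝓕_{v₀}, ℤ/N)` is cyclic
  when `𝓖_{v₀}/𝓕_{v₀}` is (the `IsAddCyclic Qg'` clause of `hdual_q`).

References (locators only; no cited FACT is declared): [cite: Jetchev2008, §5 Thm. 5.1 (p. 822), proof
of Thm. 6.3 (p. 823), Def. 4.8] [cite: Howard2004HeegnerKolyvagin, Def. 2.1.6, Thm. 2.1.11]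
[cite: MilneADT2006, Ch. I §0 (0.19), Cor. 2.3]. Design: no definitions; universe `u` for `K`.
Axioms: `propext`, `Classical.choice`, `Quot.sound`.
-/

set_option autoImplicit false

noncomputable section

open scoped Classical
open Function NumberField IsDedekindDomain WeierstrassCurve Field
open Literature.NumberTheory.EllipticCurves Literature.NumberTheory.GaloisRepresentations
open Literature.NumberTheory.GaloisCohomology
open Literature.NumberTheory.GaloisRepresentations.DiscreteGaloisModule (localTatePairingZMod
  tateDual SelmerStructure)

universe u

namespace Summit.BirchSwinnertonDyer.Rank1Residual.JET.GlobalDuality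

/-! ### Local duality at one place: the count and the cyclicity transfer (pure algebra) -/

section LocalPair

variable {X Y : Type*} [AddCommGroup X] [AddCommGroup Y] {n : ℕ} (b : X →+ Y →+ ZMod n)

/-- **Cyclicity passes through a pairing**: if `G/F` is cyclic (`F ≤ G ≤ X`) then the quotient
`F^⊥/G^⊥` of annihilators under any bi-additive `b : X × Y → ℤ/n` is cyclic — it embeds into `ℤ/n` by
`y ↦ b(g₀, y)`, `g₀` a lift of a generator. (The dual of a cyclic group is cyclic.)
[cite: MilneADT2006, Ch. I §0 (0.19)] -/
theorem isAddCyclic_dualQuotient_of_isAddCyclic (F G : AddSubgroup X)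
    (hcyc : IsAddCyclic (G ⧸ F.addSubgroupOf G)) :
    IsAddCyclic ((⨅ s ∈ F, (b s).ker : AddSubgroup Y) ⧸
      (⨅ s ∈ G, (b s).ker : AddSubgroup Y).addSubgroupOf (⨅ s ∈ F, (b s).ker : AddSubgroup Y)) := by
  obtain ⟨γ, hγ⟩ := hcyc.exists_generator
  obtain ⟨g₀, rfl⟩ := QuotientAddGroup.mk_surjective γ
  -- `φ y = b g₀ y` on `F^⊥`
  let φ : (⨅ s ∈ F, (b s).ker : AddSubgroup Y) →+ ZMod n := (b (g₀ : X)).comp (AddSubgroup.subtype _)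
  have hker : φ.ker = (⨅ s ∈ G, (b s).ker : AddSubgroup Y).addSubgroupOf (⨅ s ∈ F, (b s).ker) := by
    ext y
    rw [AddMonoidHom.mem_ker, AddSubgroup.mem_addSubgroupOf, mem_iInf_ker_iff]
    have hyF := (mem_iInf_ker_iff b F (y : Y)).mp y.2
    constructor
    · intro hy a ha
      obtain ⟨k, hk⟩ := AddSubgroup.mem_zmultiples_iff.mp (hγ (QuotientAddGroup.mk ⟨a, ha⟩))
      rw [← QuotientAddGroup.mk_zsmul, QuotientAddGroup.eq, AddSubgroup.mem_addSubgroupOf] at hk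
      have h1 : b (-(k • (g₀ : X)) + a) y = 0 := hyF _ (by simpa using hk)
      rw [map_add, map_neg, map_zsmul, AddMonoidHom.add_apply, AddMonoidHom.neg_apply,
        AddMonoidHom.zsmul_apply] at h1
      have h2 : b (g₀ : X) y = 0 := hy
      rwa [h2, smul_zero, neg_zero, zero_add] at h1
    · intro hy
      exact hy _ g₀.2
  haveI : IsAddCyclic ((⨅ s ∈ F, (b s).ker : AddSubgroup Y) ⧸ φ.ker) :=
    isAddCyclic_of_injective (QuotientAddGroup.kerLift φ) (QuotientAddGroup.kerLift_injective φ)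
  exact isAddCyclic_of_surjective (QuotientAddGroup.quotientAddEquivOfEq hker)
    (QuotientAddGroup.quotientAddEquivOfEq hker).surjective

variable [Finite X] [Finite Y] [NeZero n] (hX : ∀ x : X, n • x = 0) (hY : ∀ y : Y, n • y = 0)
  (hl : Injective b) (hr : Injective b.flip)
include hX hY hl hr

/-- **`[F^⊥ : G^⊥] = [G : F]`** for `F ≤ G ≤ X` under a perfect `ℤ/n`-pairing `b : X × Y → ℤ/n` of finite
groups killed by `n` (`#S^⊥ · #S = #Y` twice). [cite: MilneADT2006, Ch. I §0 (0.19), Cor. 2.3] -/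
theorem relIndex_iInf_ker_eq (F G : AddSubgroup X) (hFG : F ≤ G) :
    (⨅ s ∈ G, (b s).ker : AddSubgroup Y).relIndex (⨅ s ∈ F, (b s).ker : AddSubgroup Y) =
      F.relIndex G := by
  have hF := natCard_iInf_ker_mul_natCard b hX hY hl hr F
  have hG := natCard_iInf_ker_mul_natCard b hX hY hl hr G
  have hanti : (⨅ s ∈ G, (b s).ker : AddSubgroup Y) ≤ ⨅ s ∈ F, (b s).ker := iInf_ker_anti b hFG
  have h1 : Nat.card F * F.relIndex G = Nat.card G := by
    rw [← AddSubgroup.relIndex_bot_left, ← AddSubgroup.relIndex_bot_left,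
      AddSubgroup.relIndex_mul_relIndex ⊥ F G bot_le hFG]
  have h2 : Nat.card (⨅ s ∈ G, (b s).ker : AddSubgroup Y) *
      (⨅ s ∈ G, (b s).ker : AddSubgroup Y).relIndex (⨅ s ∈ F, (b s).ker : AddSubgroup Y) =
      Nat.card (⨅ s ∈ F, (b s).ker : AddSubgroup Y) := by
    rw [← AddSubgroup.relIndex_bot_left, ← AddSubgroup.relIndex_bot_left,
      AddSubgroup.relIndex_mul_relIndex ⊥ _ _ bot_le hanti]
  have hpos : 0 < Nat.card (⨅ s ∈ G, (b s).ker : AddSubgroup Y) * Nat.card F :=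
    Nat.mul_pos Nat.card_pos Nat.card_pos
  apply Nat.eq_of_mul_eq_mul_left hpos
  calc Nat.card (⨅ s ∈ G, (b s).ker : AddSubgroup Y) * Nat.card F *
        (⨅ s ∈ G, (b s).ker : AddSubgroup Y).relIndex (⨅ s ∈ F, (b s).ker : AddSubgroup Y)
      = Nat.card (⨅ s ∈ F, (b s).ker : AddSubgroup Y) * Nat.card F := by
          rw [mul_right_comm, h2]
    _ = Nat.card (⨅ s ∈ G, (b s).ker : AddSubgroup Y) * Nat.card G := by rw [hF, hG]
    _ = Nat.card (⨅ s ∈ G, (b s).ker : AddSubgroup Y) * Nat.card F * F.relIndex G := by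
          rw [mul_assoc, h1]

end LocalPair

/-! ### The dual local condition as an annihilator; the local count at a finite place -/

section DualLocal

variable {K : Type u} [Field K] [NumberField K] {N : ℕ}
  {M : Type u} [AddCommGroup M] [TopologicalSpace M] [DiscreteTopology M] [Finite M]

/-- The dual local condition IS the annihilator `⨅ a ∈ L, ker ⟨a, ·⟩_v` (unfolding Howard Def. 2.1.6).
[cite: Howard2004HeegnerKolyvagin, Def. 2.1.6] -/
theorem dualLocalCondition_eq_iInf_ker (inv : LocalInvariants K N) (ρ : DiscreteGaloisModule K M)
    (v : Place K) (L : AddSubgroup (galoisCohomology (ρ.toLocal v) 1)) :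
    inv.dualLocalCondition ρ v L =
      ⨅ a ∈ L, (localTatePairingZMod ρ N v (inv v) a).ker := by
  ext y
  rw [mem_iInf_ker_iff, LocalInvariants.mem_dualLocalCondition_iff]

variable [NeZero N]

/-- **`[F^⊥ : G^⊥] = [G : F]` at a finite place** for local conditions `F ≤ G ≤ H¹(K_v, M)` and a family
with local Tate duality at `v`. [cite: MilneADT2006, Ch. I, Cor. 2.3] [cite: Jetchev2008, Thm. 5.1] -/
theorem relIndex_dualLocalCondition_eq (inv : LocalInvariants K N) (hperf : inv.IsPerfect)
    (ρ : DiscreteGaloisModule K M) (hM : ∀ m : M, N • m = 0) (v : HeightOneSpectrum (𝓞 K))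
    (F G : AddSubgroup (galoisCohomology (ρ.toLocal (Sum.inr v : Place K)) 1)) (hFG : F ≤ G) :
    (inv.dualLocalCondition ρ (Sum.inr v : Place K) G).relIndex
        (inv.dualLocalCondition ρ (Sum.inr v : Place K) F) = F.relIndex G := by
  haveI := finite_galoisCohomology_one_toLocal ρ v
  haveI := finite_galoisCohomology_one_tateDual_toLocal ρ N v
  rw [dualLocalCondition_eq_iInf_ker, dualLocalCondition_eq_iInf_ker]
  exact relIndex_iInf_ker_eq _
    (fun x => galoisCohomology.nsmul_eq_zero_of_forall _ hM x)
    (fun y => galoisCohomology.nsmul_eq_zero_of_forall _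
      (fun f => DiscreteGaloisModule.TateDual.nsmul_eq_zero f) y)
    ((hperf v).2 ρ hM).1.injective ((hperf v).2 ρ hM).2.injective F G hFG

omit [NeZero N] in
/-- **`F^⊥/G^⊥` is cyclic when `G/F` is** (local conditions at a place; the dual of a cyclic group is
cyclic). [cite: MilneADT2006, Ch. I §0 (0.19)] -/
theorem isAddCyclic_dualLocalCondition_quotient (inv : LocalInvariants K N) (ρ : DiscreteGaloisModule K M)
    (v : Place K) (F G : AddSubgroup (galoisCohomology (ρ.toLocal v) 1))
    (hcyc : IsAddCyclic (G ⧸ F.addSubgroupOf G)) :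
    IsAddCyclic (inv.dualLocalCondition ρ v F ⧸
      (inv.dualLocalCondition ρ v G).addSubgroupOf (inv.dualLocalCondition ρ v F)) := by
  rw [dualLocalCondition_eq_iInf_ker, dualLocalCondition_eq_iInf_ker]
  exact isAddCyclic_dualQuotient_of_isAddCyclic _ F G hcyc

end DualLocal

/-! ### Eigenclasses: the condition at `σ v₀` follows from the one at `v₀` -/

section Pair

variable {K : Type u} [Field K] [NumberField K] (W : WeierstrassCurve ℚ) (σ : K ≃ₐ[ℚ] K) (n : ℤ)
  {N : ℕ}

/-- For an `s`-eigenclass `x` of `conjAct` (`s = ±1`): `loc_w x = s • σ_* (loc_v x)` for `σ • v = w`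
(`σ_* ∘ loc_v = loc_w ∘ σ_*`, `conjActPlace_localization`). [cite: Jetchev2008, §5 Thm. 5.1] -/
theorem localization_eq_smul_conjActPlace {s : ℤ} (hs : s = 1 ∨ s = -1)
    {x : galoisCohomology ((W.baseChange K).torsionGaloisModule n) 1} (hx : conjAct W σ n x = s • x)
    {v w : HeightOneSpectrum (𝓞 K)} (h : σ • v = w) :
    galoisCohomology.localization ((W.baseChange K).torsionGaloisModule n) (Sum.inr w : Place K) 1 x =
      s • conjActPlace W σ n h
        (galoisCohomology.localization ((W.baseChange K).torsionGaloisModule n) (Sum.inr v : Place K) 1 x) := by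
  rcases hs with rfl | rfl
  · rw [one_zsmul] at hx
    rw [one_zsmul, conjActPlace_localization W σ n h x, hx]
  · rw [neg_one_zsmul] at hx
    rw [neg_one_zsmul, conjActPlace_localization W σ n h x, hx, map_neg, neg_neg]

/-- Dual side: for an `s`-eigenclass `y` of `conjActDual`, `loc'_w y = s • σ_* (loc'_v y)`.
[cite: Jetchev2008, §5 Thm. 5.1] -/
theorem localization_eq_smul_conjActPlaceDual [Finite (geomTorsion (W.baseChange K) n)] {s : ℤ}
    (hs : s = 1 ∨ s = -1)
    {y : galoisCohomology (((W.baseChange K).torsionGaloisModule n).tateDual N) 1}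
    (hy : conjActDual W σ n N y = s • y) {v w : HeightOneSpectrum (𝓞 K)} (h : σ • v = w) :
    galoisCohomology.localization (((W.baseChange K).torsionGaloisModule n).tateDual N)
        (Sum.inr w : Place K) 1 y =
      s • conjActPlaceDual W σ n N h (galoisCohomology.localization
        (((W.baseChange K).torsionGaloisModule n).tateDual N) (Sum.inr v : Place K) 1 y) := by
  rcases hs with rfl | rfl
  · rw [one_zsmul] at hy
    rw [one_zsmul, conjActPlaceDual_localization W σ n N h y, hy]
  · rw [neg_one_zsmul] at hy
    rw [neg_one_zsmul, conjActPlaceDual_localization W σ n N h y, hy, map_neg, neg_neg]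

/-- **On `s`-eigenclasses of `H¹_𝓖`, membership in `H¹_𝓕` is decided at `v₀`** when `𝓕 ≤ 𝓖` agree
off the pair `{v₀, σ v₀}` and `𝓕` is `σ`-stable: `x ∈ H¹_𝓕 ↔ loc_{v₀} x ∈ 𝓕_{v₀}` (the kernel of
`locq : H¹_𝓖 ∩ H^s → 𝓖_{v₀}/𝓕_{v₀}` is `H¹_𝓕 ∩ H^s`). [cite: Jetchev2008, Thm. 5.1 and proof of Thm. 6.3 (p. 823)] -/
theorem mem_selmerGroup_iff_localization_mem_of_pair {s : ℤ} (hs : s = 1 ∨ s = -1)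
    {𝓕 𝓖 : SelmerStructure ((W.baseChange K).torsionGaloisModule n)}
    (v₀ : HeightOneSpectrum (𝓞 K))
    (hoff : ∀ v : Place K, v ≠ Sum.inr v₀ → v ≠ Sum.inr (σ • v₀) → 𝓕 v = 𝓖 v)
    (h𝓕σ : ∀ x : galoisCohomology (((W.baseChange K).torsionGaloisModule n).toLocal (Sum.inr v₀ : Place K)) 1,
      x ∈ 𝓕 (Sum.inr v₀) → conjActPlace W σ n (rfl : σ • v₀ = σ • v₀) x ∈ 𝓕 (Sum.inr (σ • v₀)))
    {x : galoisCohomology ((W.baseChange K).torsionGaloisModule n) 1} (hxG : x ∈ 𝓖.selmerGroup)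
    (hx : conjAct W σ n x = s • x) :
    x ∈ 𝓕.selmerGroup ↔
      galoisCohomology.localization ((W.baseChange K).torsionGaloisModule n) (Sum.inr v₀ : Place K) 1 x ∈
        𝓕 (Sum.inr v₀) := by
  rw [SelmerStructure.mem_selmerGroup_iff] at hxG ⊢
  refine ⟨fun h => h _, fun h v => ?_⟩
  by_cases h1 : v = Sum.inr v₀
  · subst h1; exact h
  by_cases h2 : v = Sum.inr (σ • v₀)
  · subst h2
    rw [localization_eq_smul_conjActPlace W σ n hs hx (rfl : σ • v₀ = σ • v₀)]
    exact AddSubgroup.zsmul_mem _ (h𝓕σ _ h) s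
  · rw [hoff v h1 h2]; exact hxG v

/-- **Dual side: on `s`-eigenclasses of `H¹_{𝓕^*}`, membership in `H¹_{𝓖^*}` is decided at `v₀`**:
`y ∈ H¹_{𝓖^*} ↔ loc'_{v₀} y ∈ 𝓖_{v₀}^⊥` (for `𝓕 ≤ 𝓖` agreeing off `{v₀, σ v₀}`, `𝓖` `σ`-stable in
both directions, `inv` conjugation compatible) — the kernel of `locq' : H¹_{𝓕^*} ∩ (H^D)^s →
𝓕_{v₀}^⊥/𝓖_{v₀}^⊥` is `H¹_{𝓖^*} ∩ (H^D)^s`. [cite: Jetchev2008, Thm. 5.1 and proof of Thm. 6.3 (p. 823)] -/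
theorem mem_dualSelmerGroup_iff_localization_mem_of_pair [Finite (geomTorsion (W.baseChange K) n)]
    (hσ : σ * σ = 1) {s : ℤ} (hs : s = 1 ∨ s = -1) (inv : LocalInvariants K N)
    (hinv : inv.IsConjCompatible σ)
    {𝓕 𝓖 : SelmerStructure ((W.baseChange K).torsionGaloisModule n)}
    (v₀ : HeightOneSpectrum (𝓞 K))
    (hoff : ∀ v : Place K, v ≠ Sum.inr v₀ → v ≠ Sum.inr (σ • v₀) → 𝓕 v = 𝓖 v)
    (h𝓖σ : ∀ (v w : HeightOneSpectrum (𝓞 K)) (h : σ • v = w)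
      (x : galoisCohomology (((W.baseChange K).torsionGaloisModule n).toLocal (Sum.inr v : Place K)) 1),
      x ∈ 𝓖 (Sum.inr v) → conjActPlace W σ n h x ∈ 𝓖 (Sum.inr w))
    {y : galoisCohomology (((W.baseChange K).torsionGaloisModule n).tateDual N) 1}
    (hyF : y ∈ (inv.dualSelmerStructure ((W.baseChange K).torsionGaloisModule n) 𝓕).selmerGroup)
    (hy : conjActDual W σ n N y = s • y) :
    y ∈ (inv.dualSelmerStructure ((W.baseChange K).torsionGaloisModule n) 𝓖).selmerGroup ↔
      galoisCohomology.localization (((W.baseChange K).torsionGaloisModule n).tateDual N)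
          (Sum.inr v₀ : Place K) 1 y ∈
        inv.dualLocalCondition ((W.baseChange K).torsionGaloisModule n) (Sum.inr v₀ : Place K) (𝓖 (Sum.inr v₀)) := by
  rw [SelmerStructure.mem_selmerGroup_iff] at hyF ⊢
  refine ⟨fun h => h _, fun h v => ?_⟩
  by_cases h1 : v = Sum.inr v₀
  · subst h1; exact h
  by_cases h2 : v = Sum.inr (σ • v₀)
  · subst h2
    rw [LocalInvariants.dualSelmerStructure_apply,
      localization_eq_smul_conjActPlaceDual W σ n hs hy (rfl : σ • v₀ = σ • v₀)]
    exact AddSubgroup.zsmul_mem _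
      (conjActPlaceDual_mem_dualLocalCondition W σ n N hσ inv hinv 𝓖 h𝓖σ rfl h) s
  · rw [LocalInvariants.dualSelmerStructure_apply, ← hoff v h1 h2, ← LocalInvariants.dualSelmerStructure_apply]
    exact hyF v

end Pair

/-! ### The signed counting for a swapped pair -/

section Main

variable {K : Type u} [Field K] [NumberField K] (W : WeierstrassCurve ℚ) (σ : K ≃ₐ[ℚ] K) (n : ℤ)
  {N : ℕ} [NeZero N] [Finite (geomTorsion (W.baseChange K) n)]

/-- **Signed Poitou–Tate counting for structures differing at a SWAPPED PAIR `{v₀, σ v₀}`** (Jetchev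
2008, Thm. 5.1 at a carrier `q` split in `K`, either sign `s = ±1`). Setting of the end product
`relIndex_selmerGroup_mul_relIndex_dualSelmerGroup_minus` with `𝓕 ≤ 𝓖` both `σ`-stable and EQUAL away
from `v₀ ≠ σ v₀`, `v₀ ∈ T`:

`[H¹_𝓖 ∩ H^s : H¹_𝓕 ∩ H^s] · [H¹_{𝓕^*} ∩ (H^D)^s : H¹_{𝓖^*} ∩ (H^D)^s] = [𝓖_{v₀} : 𝓕_{v₀}]`.

PROOF: the signed end products and the swapped-pair evaluation of the local index
(`relIndex_pi_inf_ker_add_id_eq_of_swap`; for `s = 1` with the involution `−τ_X`, transports `−σ_*`).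
[cite: Jetchev2008, §5 Thm. 5.1 (p. 822), proof of Thm. 6.3 (p. 823)]
[cite: Howard2004HeegnerKolyvagin, Thm. 2.1.11] [cite: MilneADT2006, Ch. I §0 (0.19)] -/
theorem relIndex_mul_relIndex_eq_of_pair (hσ : σ * σ = 1) (hN : Odd N)
    (hM : ∀ P : geomTorsion (W.baseChange K) n, N • P = 0)
    (inv : LocalInvariants K N) (hperf : inv.IsPerfect) (hvan : inv.SumLocalTermEqZero)
    (hSC : inv.SelmerComplement) (hinv : inv.IsConjCompatible σ)
    (S : Finset (Place K)) (T : Finset (HeightOneSpectrum (𝓞 K)))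
    (hT : ∀ v, (Sum.inr v : Place K) ∈ S ↔ v ∈ T) (hTσ : ∀ t ∈ T, σ • t ∈ T)
    (hS : ∀ v : HeightOneSpectrum (𝓞 K), (Sum.inr v : Place K) ∉ S →
      ((N : ℕ) : 𝓞 K) ∉ v.asIdeal ∧ GaloisRep.IsUnramifiedAt v ((W.baseChange K).torsionGaloisModule n))
    {𝓕 𝓖 : SelmerStructure ((W.baseChange K).torsionGaloisModule n)} (hle : 𝓕 ≤ 𝓖)
    (h𝓕 : 𝓕.IsUnramifiedOutside S) (h𝓖 : 𝓖.IsUnramifiedOutside S)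
    (h𝓕σ : ∀ (v w : HeightOneSpectrum (𝓞 K)) (h : σ • v = w)
      (x : galoisCohomology (((W.baseChange K).torsionGaloisModule n).toLocal (Sum.inr v : Place K)) 1),
      x ∈ 𝓕 (Sum.inr v) → conjActPlace W σ n h x ∈ 𝓕 (Sum.inr w))
    (h𝓖σ : ∀ (v w : HeightOneSpectrum (𝓞 K)) (h : σ • v = w)
      (x : galoisCohomology (((W.baseChange K).torsionGaloisModule n).toLocal (Sum.inr v : Place K)) 1),
      x ∈ 𝓖 (Sum.inr v) → conjActPlace W σ n h x ∈ 𝓖 (Sum.inr w))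
    (h𝓕inf : ∀ w : InfinitePlace K, 𝓕 (Sum.inl w) = ⊤)
    (h𝓖inf : ∀ w : InfinitePlace K, 𝓖 (Sum.inl w) = ⊤)
    (h𝓕dinf : ∀ w : InfinitePlace K,
      inv.dualSelmerStructure ((W.baseChange K).torsionGaloisModule n) 𝓕 (Sum.inl w) = ⊤)
    {v₀ : HeightOneSpectrum (𝓞 K)} (hv₀T : v₀ ∈ T) (hv₀ : σ • v₀ ≠ v₀)
    (hoff : ∀ v ∈ T, v ≠ v₀ → v ≠ σ • v₀ → 𝓕 (Sum.inr v) = 𝓖 (Sum.inr v))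
    {s : ℤ} (hs : s = 1 ∨ s = -1) :
    (𝓕.selmerGroup ⊓ (conjAct W σ n - s • AddMonoidHom.id _).ker).relIndex
        (𝓖.selmerGroup ⊓ (conjAct W σ n - s • AddMonoidHom.id _).ker) *
      ((inv.dualSelmerStructure ((W.baseChange K).torsionGaloisModule n) 𝓖).selmerGroup ⊓
          (conjActDual W σ n N - s • AddMonoidHom.id _).ker).relIndex
        ((inv.dualSelmerStructure ((W.baseChange K).torsionGaloisModule n) 𝓕).selmerGroup ⊓
          (conjActDual W σ n N - s • AddMonoidHom.id _).ker) =
      (𝓕 (Sum.inr v₀)).relIndex (𝓖 (Sum.inr v₀)) := by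
  -- transport data (the two place involutions coincide: both are `σ • ·`)
  obtain ⟨π, eX, τX, hπ, hπσ, heX, hτX, hround, -⟩ := exists_piTransport_conjActPlace W σ n hσ T hTσ
  obtain ⟨π', eY, τY, -, hπσ', heY, hτY, -, -⟩ := exists_piTransport_conjActPlaceDual W σ n N hσ T hTσ
  have hππ : π = π' := funext fun j => Subtype.ext ((hπσ j).trans (hπσ' j).symm)
  subst hππ
  -- the swapped index
  set j₀ : T := ⟨v₀, hv₀T⟩ with hj₀
  have hj : π j₀ ≠ j₀ := fun h => hv₀ (by rw [← hπσ j₀, h])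
  have hπj₀ : σ • v₀ = ((π j₀ : T) : HeightOneSpectrum (𝓞 K)) := (hπσ j₀).symm
  have hoff' : ∀ i : T, i ≠ j₀ → i ≠ π j₀ → 𝓕 (Sum.inr (i : HeightOneSpectrum (𝓞 K))) =
      𝓖 (Sum.inr (i : HeightOneSpectrum (𝓞 K))) := fun i h1 h2 =>
    hoff i i.2 (fun h => h1 (Subtype.ext h)) (fun h => h2 (Subtype.ext (h.trans hπj₀)))
  have sF : ∀ y, y ∈ 𝓕 (Sum.inr (j₀ : HeightOneSpectrum (𝓞 K))) →
      eX j₀ (π j₀) y ∈ 𝓕 (Sum.inr ((π j₀ : T) : HeightOneSpectrum (𝓞 K))) := fun y hy => by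
    rw [heX j₀ (π j₀) hπj₀]; exact h𝓕σ _ _ hπj₀ y hy
  have sG : ∀ y, y ∈ 𝓖 (Sum.inr (j₀ : HeightOneSpectrum (𝓞 K))) →
      eX j₀ (π j₀) y ∈ 𝓖 (Sum.inr ((π j₀ : T) : HeightOneSpectrum (𝓞 K))) := fun y hy => by
    rw [heX j₀ (π j₀) hπj₀]; exact h𝓖σ _ _ hπj₀ y hy
  rcases hs with rfl | rfl
  · -- `s = 1`: the `+` parts, local index through `−τ_X`
    have hend := relIndex_selmerGroup_mul_relIndex_dualSelmerGroup_plus W σ n hσ hN hM inv hperf hvan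
      hSC hinv S T hT hS hle h𝓕 h𝓖 h𝓕σ h𝓖σ h𝓕inf h𝓖inf h𝓕dinf π hπ hπσ eX heX τX hτX eY heY τY hτY
    simp only [ker_sub_one_zsmul_id]
    have hτX' : ∀ x j, (-τX) x j = (fun i j => -(eX i j)) (π j) j (x (π j)) := fun x j => by
      rw [AddMonoidHom.neg_apply, Pi.neg_apply, hτX, AddMonoidHom.neg_apply]
    rw [hend, ← ker_neg_add_id τX,
      relIndex_pi_inf_ker_add_id_eq_of_swap π (fun i j => -(eX i j)) (-τX) hτX' _ _ hπ j₀ hj hoff'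
        (fun y => by simp only [AddMonoidHom.neg_apply, map_neg, neg_neg, hround])
        (fun y hy => by rw [AddMonoidHom.neg_apply]; exact neg_mem (sF y hy))
        (fun y hy => by rw [AddMonoidHom.neg_apply]; exact neg_mem (sG y hy))]
  · -- `s = −1`: the `−` parts
    have hend := relIndex_selmerGroup_mul_relIndex_dualSelmerGroup_minus W σ n hσ hN hM inv hperf hvan
      hSC hinv S T hT hS hle h𝓕 h𝓖 h𝓕σ h𝓖σ h𝓕inf h𝓖inf h𝓕dinf π hπ hπσ eX heX τX hτX eY heY τY hτY
    simp only [ker_sub_neg_one_zsmul_id]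
    rw [hend, relIndex_pi_inf_ker_add_id_eq_of_swap π eX τX hτX _ _ hπ j₀ hj hoff' (hround j₀) sF sG]

end Main

end Summit.BirchSwinnertonDyer.Rank1Residual.JET.GlobalDuality

end
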